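import Literature.Analysis.FluidPDE.LocalTypeILscGradientTools
import Literature.Analysis.FluidPDE.CaloricTestFieldCalculus
import HarnessLib

/-!
# The heat operator of a cut-off field with weak derivatives, tested against a smooth field

Analysis/FluidPDE support file (everything proved) on the decomposition path of the named fact
`Literature.Analysis.FluidPDE.ParabolicSobolevHolderEmbedding` (Seregin 2014, §4.6, Prop. 6.8,
the parabolic embedding `W^{2,1}_{s,n}(Q) ⊂ C^μ(Q̄(1/2))`). The planned discharge localises a field
`v` with a weak time derivative `vₜ`, a weak spatial gradient `G = ∇v` and a weak spatial Hessian
`H = ∇²v` on an open space–time region `Q` by a smooth cut-off `φ`, and represents `φv` as the heat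
potential of `f = (∂ₜ - Δ)(φv) = φ vₜ + (∂ₜφ) v - φ tr H - 2 ∇v ∇φ - (Δφ) v`. The identity behind
this is the subject of the present file: for a second smooth field `η` such that
`tsupport φ ∩ tsupport η` lies in a compact subset of `Q` (so that `φη ∈ C_c^∞(Q)` although
neither factor need be compactly supported in `Q`) and every constant vector `c`,

  `∫ φ (∂ₜη + Δη) ⟪v, c⟫ = -∫ φη ⟪vₜ, c⟫ - ∫ (∂ₜφ) η ⟪v, c⟫
      + Σᵢ ( ∫ φη ⟪H eᵢ eᵢ, c⟫ + 2 ∫ (∂ᵢφ) η ⟪G eᵢ, c⟫ + ∫ (∂ᵢ∂ᵢφ) η ⟪v, c⟫ )`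

(`integral_cutoff_mul_heat_mul_inner_eq`; integrals over `ℝ × E`, `(eᵢ)` an orthonormal basis),
i.e. `∫ (φv) · (∂ₜη + Δη) c = -∫ η ⟪f, c⟫` — integration by parts once in time and twice in space,
each an instance of the defining identities of the weak derivatives with the test functions
`φη`, `φ ∂ᵢη`, `(∂ᵢφ) η ∈ C_c^∞(Q)`. The weak time derivative enters only through its defining
identity (hypothesis `ht`), so that the file does not depend on a bundled notion; the weak spatial
derivatives are the accepted `HasWeakSpatialGradientOn`.

Contents: supports and joint smoothness of the derived fields `∂ₜψ`, `∂ₐψ` of a jointly smooth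
`ψ`; the product `αβ` of two smooth fields is a test function on `Q` when
`tsupport α ∩ tsupport β ⊆ K ⊆ Q`, `K` compact (`isSpaceTimeTestOn_mul_of_tsupport_inter_subset`);
the weak-derivative identities in product-integral form and their Leibniz versions
(`integral_fderiv_mul_add_eq`, `integral_timeDeriv_mul_add_eq`); the second-order identity
`∫ φ (∂ₐ∂ₐη) ⟪v,c⟫ = ∫ φη ⟪H a a, c⟫ + 2∫ (∂ₐφ) η ⟪G a, c⟫ + ∫ (∂ₐ∂ₐφ) η ⟪v, c⟫`
(`integral_cutoff_mul_fderiv_fderiv_mul_inner_eq`); and the displayed identity.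

## References

* G. Seregin, *Lecture notes on regularity theory for the Navier–Stokes equations*, World
  Scientific (2014), §4.6 Prop. 6.8. [`Seregin2014`]
* L. C. Evans, *Partial differential equations*, 2nd ed. (2010), §5.2.1. [`Evans2010`]
-/

noncomputable section

open MeasureTheory Set Function Filter TopologicalSpace
open scoped Topology RealInnerProductSpace Laplacian ContDiff

namespace Literature.Analysis.FluidPDE

/-! ### Derived fields of a jointly smooth field: supports and smoothness -/

section Fields

variable {X : Type*} [NormedAddCommGroup X] [InnerProductSpace ℝ X]
  {F : Type*} [NormedAddCommGroup F] [NormedSpace ℝ F]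

omit [InnerProductSpace ℝ X] in
/-- The time derivative field of `ψ` is supported in the support of `ψ`. [folklore] -/
theorem tsupport_uncurry_timeDeriv_subset (ψ : ℝ → X → F) :
    tsupport (uncurry (timeDeriv ψ)) ⊆ tsupport (uncurry ψ) := by
  refine closure_minimal (fun q hq => ?_) (isClosed_tsupport _)
  obtain ⟨t, x⟩ := q
  by_contra h
  exact hq (IsSpaceTimeTestOn.timeDeriv_eq_zero_of_notMem h)

/-- The directional slice-derivative field `(t, x) ↦ ∂ₐψ(t,·)(x)` is supported in the support of
`ψ`. [folklore] -/
theorem tsupport_uncurry_fderiv_apply_subset (ψ : ℝ → X → F) (a : X) :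
    tsupport (uncurry fun t x => fderiv ℝ (ψ t) x a) ⊆ tsupport (uncurry ψ) := by
  refine closure_minimal (fun q hq => ?_) (isClosed_tsupport _)
  obtain ⟨t, x⟩ := q
  by_contra h
  exact hq (by simp [IsSpaceTimeTestOn.fderiv_slice_eq_zero_of_notMem h])

/-- The time derivative field of a jointly smooth field is jointly smooth. [folklore] -/
theorem contDiff_uncurry_timeDeriv_of_uncurry {ψ : ℝ → X → F} (hψ : ContDiff ℝ ∞ (uncurry ψ)) :
    ContDiff ℝ ∞ (uncurry (timeDeriv ψ)) := by
  have h : IsSmoothSpaceTimeOn univ ψ := by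
    rw [IsSmoothSpaceTimeOn, univ_prod_univ, contDiffOn_univ]; exact hψ
  have h1 := h.isSmoothSpaceTimeOn_deriv isOpen_univ
  rw [IsSmoothSpaceTimeOn, univ_prod_univ, contDiffOn_univ] at h1
  exact h1

/-- The directional slice-derivative field of a jointly smooth field is jointly smooth.
[folklore] -/
theorem contDiff_uncurry_fderiv_apply_of_uncurry {ψ : ℝ → X → F}
    (hψ : ContDiff ℝ ∞ (uncurry ψ)) (a : X) :
    ContDiff ℝ ∞ (uncurry fun t x => fderiv ℝ (ψ t) x a) := by
  have h : IsSmoothSpaceTimeOn univ ψ := by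
    rw [IsSmoothSpaceTimeOn, univ_prod_univ, contDiffOn_univ]; exact hψ
  have h1 := h.isSmoothSpaceTimeOn_fderiv_apply isOpen_univ a
  rw [IsSmoothSpaceTimeOn, univ_prod_univ, contDiffOn_univ] at h1
  exact h1

/-- **Products with small joint support are test functions.** If `α`, `β` are jointly smooth and
`tsupport α ∩ tsupport β ⊆ K` with `K` compact, `K ⊆ Q`, then `αβ ∈ C_c^∞(Q)`. [folklore] -/
theorem isSpaceTimeTestOn_mul_of_tsupport_inter_subset {Q : Opens (ℝ × X)} {α β : ℝ → X → ℝ}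
    (hα : ContDiff ℝ ∞ (uncurry α)) (hβ : ContDiff ℝ ∞ (uncurry β)) {K : Set (ℝ × X)}
    (hK : IsCompact K) (hKQ : K ⊆ (Q : Set (ℝ × X)))
    (h : tsupport (uncurry α) ∩ tsupport (uncurry β) ⊆ K) :
    IsSpaceTimeTestOn Q (fun t x => α t x * β t x) := by
  have e : uncurry (fun t x => α t x * β t x) = uncurry α * uncurry β := rfl
  refine ⟨?_, ?_, ?_⟩
  · rw [e]; exact hα.mul hβ
  · refine HasCompactSupport.intro hK fun z hz => ?_
    have hz' : z ∉ tsupport (uncurry α) ∩ tsupport (uncurry β) := fun h' => hz (h h')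
    show α z.1 z.2 * β z.1 z.2 = 0
    rcases not_and_or.1 hz' with h1 | h1
    · rw [show α z.1 z.2 = uncurry α z from rfl, image_eq_zero_of_notMem_tsupport h1, zero_mul]
    · rw [show β z.1 z.2 = uncurry β z from rfl, image_eq_zero_of_notMem_tsupport h1, mul_zero]
  · rw [e]
    exact (subset_inter (tsupport_mul_subset_left (f := uncurry α) (g := uncurry β))
      (tsupport_mul_subset_right (f := uncurry α) (g := uncurry β))).trans (h.trans hKQ)

omit [InnerProductSpace ℝ X] in
/-- Off `K ⊇ tsupport α ∩ tsupport β`, a point lies off the support of `α` or off that of `β`.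
[folklore] -/
theorem notMem_tsupport_or_of_notMem {K : Set (ℝ × X)} {α β : ℝ → X → ℝ}
    (h : tsupport (uncurry α) ∩ tsupport (uncurry β) ⊆ K)
    {z : ℝ × X} (hz : z ∉ K) : z ∉ tsupport (uncurry α) ∨ z ∉ tsupport (uncurry β) :=
  not_and_or.1 fun h' => hz (h h')

end Fields

/-! ### The weak-derivative identities in product-integral form -/

section Weak

variable {E : Type*} [NormedAddCommGroup E] [InnerProductSpace ℝ E] [FiniteDimensional ℝ E]
  [MeasurableSpace E] [BorelSpace E]

/-- A locally integrable field times a continuous weight vanishing off a compact `K ⊆ Q` gives an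
integrable scalar `T ⟪u, c⟫` on `ℝ × E`. [folklore] -/
theorem integrable_weight_mul_inner {Q : Opens (ℝ × E)} {u : ℝ → E → E}
    (hu : LocallyIntegrableOn (uncurry u) (Q : Set (ℝ × E)) volume) {T : ℝ × E → ℝ}
    (hT : Continuous T) {K : Set (ℝ × E)} (hK : IsCompact K) (hKQ : K ⊆ (Q : Set (ℝ × E)))
    (hT0 : ∀ z ∉ K, T z = 0) (c : E) :
    Integrable (fun z : ℝ × E => T z * ⟪u z.1 z.2, c⟫) (volume : Measure (ℝ × E)) := by
  have h := integrable_inner_of_locallyIntegrableOn hu (w := fun z => T z • c)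
    (hT.smul continuous_const) hK hKQ (fun z hz => by simp [hT0 z hz])
  exact h.congr (ae_of_all _ fun z => by simp only [real_inner_smul_right])

/-- A locally integrable operator field times a continuous weight vanishing off a compact
`K ⊆ Q` gives an integrable scalar `T ⟪G a, c⟫` on `ℝ × E`. [folklore] -/
theorem integrable_weight_mul_inner_apply {Q : Opens (ℝ × E)} {G : ℝ → E → E →L[ℝ] E}
    (hG : LocallyIntegrableOn (uncurry G) (Q : Set (ℝ × E)) volume) {T : ℝ × E → ℝ}
    (hT : Continuous T) {K : Set (ℝ × E)} (hK : IsCompact K) (hKQ : K ⊆ (Q : Set (ℝ × E)))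
    (hT0 : ∀ z ∉ K, T z = 0) (a c : E) :
    Integrable (fun z : ℝ × E => T z * ⟪G z.1 z.2 a, c⟫) (volume : Measure (ℝ × E)) := by
  have h := integrable_mul_of_locallyIntegrableOn (locallyIntegrableOn_inner_apply hG a c) hT hK
    hKQ hT0
  exact h.congr (ae_of_all _ fun z => mul_comm _ _)

/-- **The weak-gradient identity in product-integral form** (both sides over `ℝ × E`):
`∫ (∂ₐψ) ⟪u, c⟫ = -∫ ψ ⟪G a, c⟫` for `ψ ∈ C_c^∞(Q)`. [folklore] -/
theorem HasWeakSpatialGradientOn.integral_fderiv_mul_inner_eq_neg {Q : Opens (ℝ × E)}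
    {u : ℝ → E → E} {G : ℝ → E → E →L[ℝ] E} (hG : HasWeakSpatialGradientOn Q u G)
    {ψ : ℝ → E → ℝ} (hψ : IsSpaceTimeTestOn Q ψ) (a c : E) :
    ∫ z : ℝ × E, fderiv ℝ (ψ z.1) z.2 a * ⟪u z.1 z.2, c⟫ =
      -∫ z : ℝ × E, ψ z.1 z.2 * ⟪G z.1 z.2 a, c⟫ := by
  have h := setIntegral_mul_inner_weakGradient_eq hG hψ a c
  have hzero : ∀ w ∉ (Q : Set (ℝ × E)), ψ w.1 w.2 * ⟪G w.1 w.2 a, c⟫ = 0 := fun w hw => by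
    rw [hψ.apply_eq_zero (t := w.1) (x := w.2) hw, zero_mul]
  rw [setIntegral_eq_integral_of_forall_compl_eq_zero hzero] at h
  rw [h, neg_neg]

/-- **The weak-time-derivative identity in product-integral form**: if
`∫∫ (∂ₜθ) ⟪v, w⟫ = -∫∫ θ ⟪vₜ, w⟫` (iterated integrals) for all `θ ∈ C_c^∞(Q)`, then
`∫ (∂ₜψ) ⟪v, c⟫ = -∫ ψ ⟪vₜ, c⟫` over `ℝ × E` for `ψ ∈ C_c^∞(Q)` (Fubini: both integrands are
integrable). [folklore] -/
theorem integral_timeDeriv_mul_inner_eq_neg {Q : Opens (ℝ × E)} {v vₜ : ℝ → E → E}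
    (hv : LocallyIntegrableOn (uncurry v) (Q : Set (ℝ × E)) volume)
    (hvₜ : LocallyIntegrableOn (uncurry vₜ) (Q : Set (ℝ × E)) volume)
    (ht : ∀ θ : ℝ → E → ℝ, IsSpaceTimeTestOn Q θ → ∀ w : E,
      ∫ t, ∫ x, timeDeriv θ t x * ⟪v t x, w⟫ = -∫ t, ∫ x, θ t x * ⟪vₜ t x, w⟫)
    {ψ : ℝ → E → ℝ} (hψ : IsSpaceTimeTestOn Q ψ) (c : E) :
    ∫ z : ℝ × E, timeDeriv ψ z.1 z.2 * ⟪v z.1 z.2, c⟫ =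
      -∫ z : ℝ × E, ψ z.1 z.2 * ⟪vₜ z.1 z.2, c⟫ := by
  have hK : IsCompact (tsupport (uncurry ψ)) := hψ.hasCompactSupport
  have hKQ : tsupport (uncurry ψ) ⊆ (Q : Set (ℝ × E)) := hψ.tsupport_subset
  have hψ' : IsSpaceTimeTestOn (⊤ : Opens (ℝ × E)) ψ := hψ.mono le_top
  have hint1 : Integrable (fun z : ℝ × E => timeDeriv ψ z.1 z.2 * ⟪v z.1 z.2, c⟫) volume :=
    integrable_weight_mul_inner hv (T := fun z => timeDeriv ψ z.1 z.2)
      hψ'.timeDeriv_top.contDiff.continuous hK hKQ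
      (fun z hz => IsSpaceTimeTestOn.timeDeriv_eq_zero_of_notMem hz) c
  have hint2 : Integrable (fun z : ℝ × E => ψ z.1 z.2 * ⟪vₜ z.1 z.2, c⟫) volume :=
    integrable_weight_mul_inner hvₜ (T := fun z => ψ z.1 z.2) hψ.contDiff.continuous hK hKQ
      (fun z hz => show uncurry ψ z = 0 from image_eq_zero_of_notMem_tsupport hz) c
  have e1 : ∫ z : ℝ × E, timeDeriv ψ z.1 z.2 * ⟪v z.1 z.2, c⟫ =
      ∫ t, ∫ x, timeDeriv ψ t x * ⟪v t x, c⟫ := by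
    rw [Measure.volume_eq_prod, integral_prod _ (by rwa [← Measure.volume_eq_prod])]
  have e2 : ∫ z : ℝ × E, ψ z.1 z.2 * ⟪vₜ z.1 z.2, c⟫ = ∫ t, ∫ x, ψ t x * ⟪vₜ t x, c⟫ := by
    rw [Measure.volume_eq_prod, integral_prod _ (by rwa [← Measure.volume_eq_prod])]
  rw [e1, e2]
  exact ht ψ hψ c

/-! ### Leibniz versions -/

variable {Q : Opens (ℝ × E)} {K : Set (ℝ × E)} {α β : ℝ → E → ℝ}

/-- **Leibniz form of the weak-gradient identity**: for jointly smooth `α`, `β` with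
`tsupport α ∩ tsupport β ⊆ K ⊆ Q`, `K` compact,
`∫ (∂ₐα) β ⟪u, c⟫ + ∫ α (∂ₐβ) ⟪u, c⟫ = -∫ αβ ⟪G a, c⟫`. [folklore] -/
theorem integral_fderiv_mul_add_eq {u : ℝ → E → E} {G : ℝ → E → E →L[ℝ] E}
    (hG : HasWeakSpatialGradientOn Q u G) (hα : ContDiff ℝ ∞ (uncurry α))
    (hβ : ContDiff ℝ ∞ (uncurry β)) (hK : IsCompact K) (hKQ : K ⊆ (Q : Set (ℝ × E)))
    (h : tsupport (uncurry α) ∩ tsupport (uncurry β) ⊆ K) (a c : E) :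
    (∫ z : ℝ × E, fderiv ℝ (α z.1) z.2 a * β z.1 z.2 * ⟪u z.1 z.2, c⟫) +
      ∫ z : ℝ × E, α z.1 z.2 * fderiv ℝ (β z.1) z.2 a * ⟪u z.1 z.2, c⟫ =
      -∫ z : ℝ × E, α z.1 z.2 * β z.1 z.2 * ⟪G z.1 z.2 a, c⟫ := by
  have hψ := isSpaceTimeTestOn_mul_of_tsupport_inter_subset hα hβ hK hKQ h
  have hmain := hG.integral_fderiv_mul_inner_eq_neg hψ a c
  -- the product rule, pointwise
  have hprod : ∀ z : ℝ × E, fderiv ℝ (fun y => α z.1 y * β z.1 y) z.2 a =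
      fderiv ℝ (α z.1) z.2 a * β z.1 z.2 + α z.1 z.2 * fderiv ℝ (β z.1) z.2 a := by
    intro z
    have hαd : DifferentiableAt ℝ (α z.1) z.2 :=
      ((contDiff_slice_of_uncurry hα z.1).differentiable (by simp)).differentiableAt
    have hβd : DifferentiableAt ℝ (β z.1) z.2 :=
      ((contDiff_slice_of_uncurry hβ z.1).differentiable (by simp)).differentiableAt
    rw [fderiv_fun_mul hαd hβd]
    simp only [_root_.add_apply, FunLike.coe_smul, Pi.smul_apply, smul_eq_mul]
    ring
  -- integrability of the two pieces
  have hcα := hα.continuous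
  have hcβ := hβ.continuous
  have hcα' := (contDiff_uncurry_fderiv_apply_of_uncurry hα a).continuous
  have hcβ' := (contDiff_uncurry_fderiv_apply_of_uncurry hβ a).continuous
  have h0₁ : ∀ z ∉ K, fderiv ℝ (α z.1) z.2 a * β z.1 z.2 = 0 := fun z hz => by
    rcases notMem_tsupport_or_of_notMem h hz with h1 | h1
    · rw [IsSpaceTimeTestOn.fderiv_slice_eq_zero_of_notMem h1]; simp
    · rw [show β z.1 z.2 = uncurry β z from rfl, image_eq_zero_of_notMem_tsupport h1, mul_zero]
  have h0₂ : ∀ z ∉ K, α z.1 z.2 * fderiv ℝ (β z.1) z.2 a = 0 := fun z hz => by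
    rcases notMem_tsupport_or_of_notMem h hz with h1 | h1
    · rw [show α z.1 z.2 = uncurry α z from rfl, image_eq_zero_of_notMem_tsupport h1, zero_mul]
    · rw [IsSpaceTimeTestOn.fderiv_slice_eq_zero_of_notMem h1]; simp
  have hi₁ := integrable_weight_mul_inner hG.locallyIntegrableOn
    (T := fun z => fderiv ℝ (α z.1) z.2 a * β z.1 z.2) (hcα'.mul hcβ) hK hKQ h0₁ c
  have hi₂ := integrable_weight_mul_inner hG.locallyIntegrableOn
    (T := fun z => α z.1 z.2 * fderiv ℝ (β z.1) z.2 a) (hcα.mul hcβ') hK hKQ h0₂ c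
  rw [← integral_add hi₁ hi₂, ← hmain]
  refine integral_congr_ae (ae_of_all _ fun z => ?_)
  simp only [hprod]
  ring

/-- **Leibniz form of the weak-time-derivative identity**: for jointly smooth `α`, `β` with
`tsupport α ∩ tsupport β ⊆ K ⊆ Q`, `K` compact,
`∫ (∂ₜα) β ⟪v, c⟫ + ∫ α (∂ₜβ) ⟪v, c⟫ = -∫ αβ ⟪vₜ, c⟫`. [folklore] -/
theorem integral_timeDeriv_mul_add_eq {v vₜ : ℝ → E → E}
    (hv : LocallyIntegrableOn (uncurry v) (Q : Set (ℝ × E)) volume)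
    (hvₜ : LocallyIntegrableOn (uncurry vₜ) (Q : Set (ℝ × E)) volume)
    (ht : ∀ θ : ℝ → E → ℝ, IsSpaceTimeTestOn Q θ → ∀ w : E,
      ∫ t, ∫ x, timeDeriv θ t x * ⟪v t x, w⟫ = -∫ t, ∫ x, θ t x * ⟪vₜ t x, w⟫)
    (hα : ContDiff ℝ ∞ (uncurry α)) (hβ : ContDiff ℝ ∞ (uncurry β)) (hK : IsCompact K)
    (hKQ : K ⊆ (Q : Set (ℝ × E))) (h : tsupport (uncurry α) ∩ tsupport (uncurry β) ⊆ K) (c : E) :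
    (∫ z : ℝ × E, timeDeriv α z.1 z.2 * β z.1 z.2 * ⟪v z.1 z.2, c⟫) +
      ∫ z : ℝ × E, α z.1 z.2 * timeDeriv β z.1 z.2 * ⟪v z.1 z.2, c⟫ =
      -∫ z : ℝ × E, α z.1 z.2 * β z.1 z.2 * ⟪vₜ z.1 z.2, c⟫ := by
  have hψ := isSpaceTimeTestOn_mul_of_tsupport_inter_subset hα hβ hK hKQ h
  have hmain := integral_timeDeriv_mul_inner_eq_neg hv hvₜ ht hψ c
  have hprod : ∀ z : ℝ × E, timeDeriv (fun s y => α s y * β s y) z.1 z.2 =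
      timeDeriv α z.1 z.2 * β z.1 z.2 + α z.1 z.2 * timeDeriv β z.1 z.2 := fun z =>
    timeDeriv_mul (differentiableAt_time_of_uncurry hα (by simp) z.1 z.2)
      (differentiableAt_time_of_uncurry hβ (by simp) z.1 z.2)
  have hcα := hα.continuous
  have hcβ := hβ.continuous
  have hcα' := (contDiff_uncurry_timeDeriv_of_uncurry hα).continuous
  have hcβ' := (contDiff_uncurry_timeDeriv_of_uncurry hβ).continuous
  have h0₁ : ∀ z ∉ K, timeDeriv α z.1 z.2 * β z.1 z.2 = 0 := fun z hz => by
    rcases notMem_tsupport_or_of_notMem h hz with h1 | h1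
    · rw [IsSpaceTimeTestOn.timeDeriv_eq_zero_of_notMem h1, zero_mul]
    · rw [show β z.1 z.2 = uncurry β z from rfl, image_eq_zero_of_notMem_tsupport h1, mul_zero]
  have h0₂ : ∀ z ∉ K, α z.1 z.2 * timeDeriv β z.1 z.2 = 0 := fun z hz => by
    rcases notMem_tsupport_or_of_notMem h hz with h1 | h1
    · rw [show α z.1 z.2 = uncurry α z from rfl, image_eq_zero_of_notMem_tsupport h1, zero_mul]
    · rw [IsSpaceTimeTestOn.timeDeriv_eq_zero_of_notMem h1, mul_zero]
  have hi₁ := integrable_weight_mul_inner hv (T := fun z => timeDeriv α z.1 z.2 * β z.1 z.2)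
    (hcα'.mul hcβ) hK hKQ h0₁ c
  have hi₂ := integrable_weight_mul_inner hv (T := fun z => α z.1 z.2 * timeDeriv β z.1 z.2)
    (hcα.mul hcβ') hK hKQ h0₂ c
  rw [← integral_add hi₁ hi₂, ← hmain]
  refine integral_congr_ae (ae_of_all _ fun z => ?_)
  simp only [hprod]
  ring

/-! ### The second-order identity in one direction -/

/-- **`∫ φ (∂ₐ∂ₐη) ⟪v, c⟫ = ∫ φη ⟪H a a, c⟫ + 2 ∫ (∂ₐφ) η ⟪G a, c⟫ + ∫ (∂ₐ∂ₐφ) η ⟪v, c⟫`** for a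
field `v` with weak spatial gradient `G` whose directional derivative `G a` has weak spatial gradient
`H a` on `Q`, and jointly smooth `φ`, `η` with `tsupport φ ∩ tsupport η ⊆ K ⊆ Q`, `K` compact
(twice the Leibniz identity: with `(φ, ∂ₐη)` and `(∂ₐφ, η)` on `(v, G)`, with `(φ, η)` on
`(G a, H a)`). [folklore] -/
theorem integral_cutoff_mul_fderiv_fderiv_mul_inner_eq {v : ℝ → E → E}
    {G : ℝ → E → E →L[ℝ] E} {H : ℝ → E → E →L[ℝ] E →L[ℝ] E} {φ η : ℝ → E → ℝ}
    (hG : HasWeakSpatialGradientOn Q v G) (a : E)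
    (hH : HasWeakSpatialGradientOn Q (fun t x => G t x a) fun t x => H t x a)
    (hφ : ContDiff ℝ ∞ (uncurry φ)) (hη : ContDiff ℝ ∞ (uncurry η)) (hK : IsCompact K)
    (hKQ : K ⊆ (Q : Set (ℝ × E))) (h : tsupport (uncurry φ) ∩ tsupport (uncurry η) ⊆ K) (c : E) :
    ∫ z : ℝ × E, φ z.1 z.2 * fderiv ℝ (fun y => fderiv ℝ (η z.1) y a) z.2 a * ⟪v z.1 z.2, c⟫ =
      (∫ z : ℝ × E, φ z.1 z.2 * η z.1 z.2 * ⟪H z.1 z.2 a a, c⟫) +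
      2 * (∫ z : ℝ × E, fderiv ℝ (φ z.1) z.2 a * η z.1 z.2 * ⟪G z.1 z.2 a, c⟫) +
      ∫ z : ℝ × E, fderiv ℝ (fun y => fderiv ℝ (φ z.1) y a) z.2 a * η z.1 z.2 * ⟪v z.1 z.2, c⟫ := by
  -- the derived fields and their supports
  have hφ' := contDiff_uncurry_fderiv_apply_of_uncurry hφ a
  have hη' := contDiff_uncurry_fderiv_apply_of_uncurry hη a
  have hsφ := tsupport_uncurry_fderiv_apply_subset φ a
  have hsη := tsupport_uncurry_fderiv_apply_subset η a
  have h₁ : tsupport (uncurry φ) ∩ tsupport (uncurry fun t x => fderiv ℝ (η t) x a) ⊆ K :=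
    (inter_subset_inter_right _ hsη).trans h
  have h₂ : tsupport (uncurry fun t x => fderiv ℝ (φ t) x a) ∩ tsupport (uncurry η) ⊆ K :=
    (inter_subset_inter_left _ hsφ).trans h
  -- [II]: `(φ, ∂ₐη)` on `(v, G)`
  have hII := integral_fderiv_mul_add_eq hG hφ hη' hK hKQ h₁ a c
  -- [III]: `(φ, η)` on `(G a, H a)`
  have hIII := integral_fderiv_mul_add_eq hH hφ hη hK hKQ h a c
  -- [IV]: `(∂ₐφ, η)` on `(v, G)`
  have hIV := integral_fderiv_mul_add_eq hG hφ' hη hK hKQ h₂ a c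
  linarith

/-! ### The heat operator tested: `∫ φ (∂ₜη + Δη) ⟪v, c⟫` -/

/-- **The heat operator of a cut-off field, tested** (the identity of the file docstring): for a
field `v` on `Q` with weak time derivative `vₜ` (in the sense of the identities `ht`), weak spatial
gradient `G` and weak spatial gradients `H a` of the directional derivatives `G a`, jointly smooth
`φ`, `η` with `tsupport φ ∩ tsupport η ⊆ K ⊆ Q` (`K` compact), an orthonormal basis `(eᵢ)` and a
vector `c`,
`∫ φ (∂ₜη + Δη) ⟪v, c⟫ = -∫ φη ⟪vₜ, c⟫ - ∫ (∂ₜφ) η ⟪v, c⟫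
  + Σᵢ (∫ φη ⟪H eᵢ eᵢ, c⟫ + 2 ∫ (∂ᵢφ) η ⟪G eᵢ, c⟫ + ∫ (∂ᵢ∂ᵢφ) η ⟪v, c⟫)`,
i.e. `∫ (φv)·(∂ₜη + Δη)c = -∫ η ⟪(∂ₜ - Δ)(φv), c⟫` with
`(∂ₜ - Δ)(φv) = φvₜ + (∂ₜφ)v - φ tr H - 2 G∇φ - (Δφ)v` (Evans, §5.2.1; the integration by parts
behind Seregin 2014, Prop. 6.8 via heat potentials). [folklore] -/
theorem integral_cutoff_mul_heat_mul_inner_eq {ι : Type*} [Fintype ι] (b : OrthonormalBasis ι ℝ E)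
    {v vₜ : ℝ → E → E} {G : ℝ → E → E →L[ℝ] E} {H : ℝ → E → E →L[ℝ] E →L[ℝ] E}
    {φ η : ℝ → E → ℝ} (hG : HasWeakSpatialGradientOn Q v G)
    (hH : ∀ a : E, HasWeakSpatialGradientOn Q (fun t x => G t x a) fun t x => H t x a)
    (hvₜ : LocallyIntegrableOn (uncurry vₜ) (Q : Set (ℝ × E)) volume)
    (ht : ∀ θ : ℝ → E → ℝ, IsSpaceTimeTestOn Q θ → ∀ w : E,
      ∫ t, ∫ x, timeDeriv θ t x * ⟪v t x, w⟫ = -∫ t, ∫ x, θ t x * ⟪vₜ t x, w⟫)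
    (hφ : ContDiff ℝ ∞ (uncurry φ)) (hη : ContDiff ℝ ∞ (uncurry η)) (hK : IsCompact K)
    (hKQ : K ⊆ (Q : Set (ℝ × E))) (h : tsupport (uncurry φ) ∩ tsupport (uncurry η) ⊆ K) (c : E) :
    ∫ z : ℝ × E, φ z.1 z.2 * (timeDeriv η z.1 z.2 + Δ (η z.1) z.2) * ⟪v z.1 z.2, c⟫ =
      -(∫ z : ℝ × E, φ z.1 z.2 * η z.1 z.2 * ⟪vₜ z.1 z.2, c⟫) -
        (∫ z : ℝ × E, timeDeriv φ z.1 z.2 * η z.1 z.2 * ⟪v z.1 z.2, c⟫) +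
        ∑ i, ((∫ z : ℝ × E, φ z.1 z.2 * η z.1 z.2 * ⟪H z.1 z.2 (b i) (b i), c⟫) +
          2 * (∫ z : ℝ × E, fderiv ℝ (φ z.1) z.2 (b i) * η z.1 z.2 * ⟪G z.1 z.2 (b i), c⟫) +
          ∫ z : ℝ × E, fderiv ℝ (fun y => fderiv ℝ (φ z.1) y (b i)) z.2 (b i) * η z.1 z.2 *
            ⟪v z.1 z.2, c⟫) := by
  have hv : LocallyIntegrableOn (uncurry v) (Q : Set (ℝ × E)) volume := hG.locallyIntegrableOn
  -- time part
  have hT := integral_timeDeriv_mul_add_eq hv hvₜ ht hφ hη hK hKQ h c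
  -- space part, direction by direction
  have hS : ∀ i, ∫ z : ℝ × E, φ z.1 z.2 *
      fderiv ℝ (fun y => fderiv ℝ (η z.1) y (b i)) z.2 (b i) * ⟪v z.1 z.2, c⟫ =
      (∫ z : ℝ × E, φ z.1 z.2 * η z.1 z.2 * ⟪H z.1 z.2 (b i) (b i), c⟫) +
      2 * (∫ z : ℝ × E, fderiv ℝ (φ z.1) z.2 (b i) * η z.1 z.2 * ⟪G z.1 z.2 (b i), c⟫) +
      ∫ z : ℝ × E, fderiv ℝ (fun y => fderiv ℝ (φ z.1) y (b i)) z.2 (b i) * η z.1 z.2 *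
        ⟪v z.1 z.2, c⟫ := fun i =>
    integral_cutoff_mul_fderiv_fderiv_mul_inner_eq hG (b i) (hH (b i)) hφ hη hK hKQ h c
  -- the Laplacian of the slices of `η`
  have hΔ : ∀ z : ℝ × E, Δ (η z.1) z.2 =
      ∑ i, fderiv ℝ (fun y => fderiv ℝ (η z.1) y (b i)) z.2 (b i) := fun z =>
    laplacian_eq_sum_fderiv_fderiv_normed b
      (contDiff_infty.1 (contDiff_slice_of_uncurry hη z.1) 2) z.2
  -- integrability of the pieces on the left
  have hcφ := hφ.continuous
  have hcηt := (contDiff_uncurry_timeDeriv_of_uncurry hη).continuous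
  have hcηii : ∀ i, Continuous fun z : ℝ × E =>
      fderiv ℝ (fun y => fderiv ℝ (η z.1) y (b i)) z.2 (b i) := fun i =>
    (contDiff_uncurry_fderiv_apply_of_uncurry
      (contDiff_uncurry_fderiv_apply_of_uncurry hη (b i)) (b i)).continuous
  have h0t : ∀ z ∉ K, φ z.1 z.2 * timeDeriv η z.1 z.2 = 0 := fun z hz => by
    rcases notMem_tsupport_or_of_notMem h hz with h1 | h1
    · rw [show φ z.1 z.2 = uncurry φ z from rfl, image_eq_zero_of_notMem_tsupport h1, zero_mul]
    · rw [IsSpaceTimeTestOn.timeDeriv_eq_zero_of_notMem h1, mul_zero]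
  have h0ii : ∀ i, ∀ z ∉ K,
      φ z.1 z.2 * fderiv ℝ (fun y => fderiv ℝ (η z.1) y (b i)) z.2 (b i) = 0 := fun i z hz => by
    rcases notMem_tsupport_or_of_notMem h hz with h1 | h1
    · rw [show φ z.1 z.2 = uncurry φ z from rfl, image_eq_zero_of_notMem_tsupport h1, zero_mul]
    · have h2 : z ∉ tsupport (uncurry fun t x => fderiv ℝ (η t) x (b i)) := fun h' =>
        h1 (tsupport_uncurry_fderiv_apply_subset η (b i) h')
      have h3 := IsSpaceTimeTestOn.fderiv_slice_eq_zero_of_notMem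
        (ψ := fun t x => fderiv ℝ (η t) x (b i)) h2
      rw [h3]; simp
  have hit := integrable_weight_mul_inner hv (T := fun z => φ z.1 z.2 * timeDeriv η z.1 z.2)
    (hcφ.mul hcηt) hK hKQ h0t c
  have hiii : ∀ i, Integrable (fun z : ℝ × E => φ z.1 z.2 *
      fderiv ℝ (fun y => fderiv ℝ (η z.1) y (b i)) z.2 (b i) * ⟪v z.1 z.2, c⟫) volume := fun i =>
    integrable_weight_mul_inner hv (hcφ.mul (hcηii i)) hK hKQ (h0ii i) c
  -- expand the left-hand side
  have hL : ∫ z : ℝ × E, φ z.1 z.2 * (timeDeriv η z.1 z.2 + Δ (η z.1) z.2) * ⟪v z.1 z.2, c⟫ =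
      (∫ z : ℝ × E, φ z.1 z.2 * timeDeriv η z.1 z.2 * ⟪v z.1 z.2, c⟫) +
      ∑ i, ∫ z : ℝ × E, φ z.1 z.2 *
        fderiv ℝ (fun y => fderiv ℝ (η z.1) y (b i)) z.2 (b i) * ⟪v z.1 z.2, c⟫ := by
    rw [← integral_finsetSum _ fun i _ => hiii i, ← integral_add hit
      (integrable_finsetSum _ fun i _ => hiii i)]
    refine integral_congr_ae (ae_of_all _ fun z => ?_)
    beta_reduce
    rw [hΔ z, mul_add, add_mul, Finset.mul_sum, Finset.sum_mul]
  rw [hL, Finset.sum_congr rfl fun i _ => hS i]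
  linarith

end Weak

end Literature.Analysis.FluidPDE

end
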